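import Literature.Algebra.EuclideanLattices.RegevRoutineSemantics
import Literature.Computability.QuantumComplexity.BlockBranches
import Literature.Computability.QuantumComplexity.CoinFamilyKernel
import Literature.Computability.QuantumComplexity.CWrapFamily
import HarnessLib

/-!
# Regev's per-copy routine as a circuit family, IV: the family and its branch decomposition

Fourth file of the circuit-level construction towards `usvp_of_dihedralCoset` (layout, programs,
classical semantics in `RegevRoutineLayout/Prog/Semantics.lean`). Here the **quantum circuit
family of the routine** and the generic part of its analysis:

* `coinPos L n` — the coin wires (the `ix` field and the control bit of every coin zone, the
  `4n` data bits of each of the `n` digit fields, and the guess zone), `coinPos_nodup`,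
  `coinPos_bounds`, `coinWire_of_mem_coinPos`;
* `hGates` (a Hadamard gate on every coin wire), `clampR` (the classical program on
  `Fin (L + anc L)`), `solverGates` (the solver's circuit at `ℓ = ell n`, verbatim on the front
  wires, `Fin.castLEEmb`), **`circ`**, **`family`**, `family_isOracleFree`;
* `kappa` — the basis permutation of the compiled program, `kappa_injective`, and
  **`liftW_kappa`**: `liftW (kappa z) = clEval (prog L n) (liftW z)` (so `prog_sem` describes it);
* **`hGates_mulVec_pad`** — after the Hadamard layer the state is the uniform superposition of
  the input assignments; **`stateQ_eq`** — after the compiled program it is that superposition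
  transported along `kappa`;
* **`bornSum_product_event`** — the Born weight of a product event "off-block content in `Toff`
  and block content in `TE`" after the solver equals the sum over the off-block contents `y` of
  the event probabilities of the solver's circuit on the branches (`BlockBranches`), and
  `kernelProb_family_eq` — the output kernel of the family as that Born sum.

## References

* O. Regev, *Quantum computation and lattice problems*, SIAM J. Comput. 33 (2004), proof of
  Lemma 3.12 (p. 14) and of Thm. 1.1 (p. 7).
* M. A. Nielsen, I. L. Chuang, *Quantum Computation and Quantum Information*, CUP 2010, §1.4.4
  (`H^{⊗n}|0⟩`), §3.2.5, §4.4 (deferred measurement).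
-/

noncomputable section

namespace Literature.Algebra.EuclideanLattices

namespace RegevRoutine

open _root_.Computability Literature.Computability.Complexity Literature.Computability.Cryptography
  Literature.Computability.QuantumComplexity Literature.Computability.QuantumComplexity.ZoneGadgets
  Turing RevSim RevClean RevMux Matrix

variable (P : Params)

/-! ### The coin wires -/

/-- The coin wires of coin zone `k`: the `ix` field, the control bit, and the `4n` data bits of
each of the `n` digit fields of `ā` (each field followed by a separator wire that stays `0`).
[cite: Regev2004, Lemma 3.12 (proof, p. 14: the uniform superposition over t ∈ {0,1}, ā ∈ {0,…,M−1}ⁿ and the grid points)] -/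
def coinPosZone (L n k : ℕ) : List ℕ :=
  (List.range (kap P L + 1)).map (fun j => oC P L k + j) ++
    (List.range n).flatMap fun i => (List.range (4 * n)).map fun b => oC P L k + (kap P L + 1) + i * (4 * n + 1) + b

/-- **The coin wires**: those of every coin zone and the guess zone. [cite: Regev2004, Thm. 1.1 (proof, p. 7: the guesses l, m, i₀)] -/
def coinPos (L n : ℕ) : List ℕ :=
  (List.range (rmax P L)).flatMap (coinPosZone P L n) ++ (List.range (gam P L)).map fun j => oGz P L + j

variable {P}

/-- A data bit of digit field `i`, bit `b`, lies below the slot width. [folklore] -/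
theorem digit_lt_slotW {n i b : ℕ} (hi : i < n) (hb : b < 4 * n) : 1 + i * (4 * n + 1) + b < slotW n := by
  unfold slotW ell
  have : (i + 1) * (4 * n + 1) ≤ n * (4 * n + 1) := Nat.mul_le_mul_right _ hi
  rw [Nat.add_mul, Nat.one_mul] at this
  omega

/-- Membership in the coin wires of zone `k`. [folklore] -/
theorem mem_coinPosZone {L n k p : ℕ} : p ∈ coinPosZone P L n k ↔
    (∃ j, j < kap P L + 1 ∧ p = oC P L k + j) ∨
      (∃ i, i < n ∧ ∃ b, b < 4 * n ∧ p = oC P L k + (kap P L + 1) + i * (4 * n + 1) + b) := by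
  simp only [coinPosZone, List.mem_append, List.mem_map, List.mem_range, List.mem_flatMap]
  constructor
  · rintro (⟨j, hj, rfl⟩ | ⟨i, hi, b, hb, rfl⟩)
    · exact Or.inl ⟨j, hj, rfl⟩
    · exact Or.inr ⟨i, hi, b, hb, rfl⟩
  · rintro (⟨j, hj, rfl⟩ | ⟨i, hi, b, hb, rfl⟩)
    · exact Or.inl ⟨j, hj, rfl⟩
    · exact Or.inr ⟨i, hi, b, hb, rfl⟩

/-- Coin wires of zone `k` lie in `[oC k, oC k + kap + slotW n)`. [folklore] -/
theorem coinPosZone_bounds {L n k p : ℕ} (hp : p ∈ coinPosZone P L n k) : oC P L k ≤ p ∧ p < oC P L k + (kap P L + slotW n) := by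
  rcases mem_coinPosZone.1 hp with ⟨j, hj, rfl⟩ | ⟨i, hi, b, hb, rfl⟩
  · have : 1 ≤ slotW n := by unfold slotW; omega
    exact ⟨by omega, by omega⟩
  · have := digit_lt_slotW hi hb
    exact ⟨by omega, by omega⟩

/-- **Every coin wire is a `CoinWire`** (so the assignments met after the Hadamard layer are
input assignments). [folklore] -/
theorem coinWire_of_mem_coinPos {L n p : ℕ} (hp : p ∈ coinPos P L n) : CoinWire P L n p := by
  simp only [coinPos, List.mem_append, List.mem_flatMap, List.mem_range, List.mem_map] at hp
  rcases hp with ⟨k, hk, hp⟩ | ⟨j, hj, rfl⟩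
  · exact Or.inl ⟨k, hk, coinPosZone_bounds hp⟩
  · exact Or.inr ⟨by omega, by omega⟩

/-- Coin wires lie in `[L, Wtot)`. [folklore] -/
theorem coinPos_bounds {L n p : ℕ} (hn : n ≤ L) (hp : p ∈ coinPos P L n) : L ≤ p ∧ p < Wtot P L := by
  have hc := offsets_chain (P := P) L
  rcases coinWire_bounds hn (coinWire_of_mem_coinPos hp) with ⟨h1, h2⟩ | ⟨h1, h2⟩ <;> exact ⟨by omega, by omega⟩

/-- The coin wires of one zone are distinct. [folklore] -/
theorem coinPosZone_nodup (L n k : ℕ) : (coinPosZone P L n k).Nodup := by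
  unfold coinPosZone
  refine List.Nodup.append ?_ ?_ ?_
  · exact List.nodup_range.map_on fun a _ b _ h => by omega
  · rw [List.nodup_flatMap]
    constructor
    · intro i _; exact List.nodup_range.map_on fun a _ b _ h => by omega
    · refine List.nodup_range.pairwise_of_forall_ne ?_
      intro i hi j hj hij
      simp only [Function.onFun, List.disjoint_left, List.mem_map, List.mem_range]
      rintro _ ⟨b, hb, rfl⟩ ⟨b', hb', he⟩
      rw [List.mem_range] at hi hj
      rcases lt_or_gt_of_ne hij with h | h
      · have : (i + 1) * (4 * n + 1) ≤ j * (4 * n + 1) := Nat.mul_le_mul_right _ h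
        rw [Nat.add_mul, Nat.one_mul] at this; omega
      · have : (j + 1) * (4 * n + 1) ≤ i * (4 * n + 1) := Nat.mul_le_mul_right _ h
        rw [Nat.add_mul, Nat.one_mul] at this; omega
  · simp only [List.disjoint_left, List.mem_map, List.mem_range, List.mem_flatMap]
    rintro _ ⟨j, hj, rfl⟩ ⟨i, _, b, _, he⟩
    omega

/-- **The coin wires are distinct.** [folklore] -/
theorem coinPos_nodup {L n : ℕ} (hn : n ≤ L) : (coinPos P L n).Nodup := by
  have hc := offsets_chain (P := P) L
  unfold coinPos
  refine List.Nodup.append ?_ ?_ ?_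
  · rw [List.nodup_flatMap]
    refine ⟨fun k _ => coinPosZone_nodup L n k, List.nodup_range.pairwise_of_forall_ne ?_⟩
    intro i hi j hj hij
    simp only [Function.onFun, List.disjoint_left]
    intro p hpi hpj
    rw [List.mem_range] at hi hj
    have h1 := coinPosZone_bounds hpi
    have h2 := coinPosZone_bounds hpj
    have hsw : slotW n ≤ sig L := by unfold sig slotW; have := ell_mono hn; omega
    have hcw : cW P L = kap P L + sig L := rfl
    rcases lt_or_gt_of_ne hij with h | h
    · have := oC_add_cW_le_oC (P := P) (L := L) h; omega
    · have := oC_add_cW_le_oC (P := P) (L := L) h; omega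
  · exact List.nodup_range.map_on fun a _ b _ h => by omega
  · simp only [List.disjoint_left, List.mem_map, List.mem_range, List.mem_flatMap]
    rintro p ⟨k, hk, hp⟩ ⟨j, hj, rfl⟩
    have h1 := coinPosZone_bounds hp
    have := cBase_le_oC (P := P) L k
    omega

/-! ### The circuits -/

/-- The register is nonempty. [folklore] -/
theorem width_pos (L : ℕ) : 0 < L + anc P L := by
  have hc := offsets_chain (P := P) L
  have : 1 ≤ rmax P L * sig L := Nat.one_le_iff_ne_zero.2 (Nat.mul_ne_zero (by unfold rmax; omega) (by unfold sig slotW; omega))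
  rw [add_anc]; omega

variable (P)

/-- The coin wires as wires of the register. [folklore] -/
def coinFin (L : ℕ) : List (Fin (L + anc P L)) := (coinPos P L (nOf L)).map (finOf (L + anc P L) (width_pos L))

/-- **The Hadamard layer**: one `H` on every coin wire. [cite: NielsenChuang2010, §1.4.4 (H^{⊗n}|0⟩)] -/
def hGates (L : ℕ) : List (QGate cliffordT (L + anc P L)) := (coinFin P L).map hOn

/-- **The classical program on the wires of the register** (as reversible operations). [folklore] -/
def clampR (L : ℕ) : List (RevOp (L + anc P L)) :=
  toRevList ((prog P L (nOf L)).map (ClOp.map (finOf (L + anc P L) (width_pos L)))) fun op hop => by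
    simp only [List.mem_map] at hop
    obtain ⟨op, hop, rfl⟩ := hop
    exact wf_map_finOf _ (prog_lt' (nOf_le L) op hop) (prog_wf (nOf_le L) op hop)

/-- The solver's wires at `ℓ = ell (nOf L)` fit into the register. [folklore] -/
theorem solver_fits' (L : ℕ) : ell (nOf L) + P.FD.ancillas (ell (nOf L)) ≤ L + anc P L := by
  have h1 := solver_fits (P := P) (nOf_le L)
  have hc := offsets_chain (P := P) L
  rw [add_anc]; omega

/-- The embedding of the solver's wires: the front wires. [folklore] -/
def solverEmb (L : ℕ) : Fin (ell (nOf L) + P.FD.ancillas (ell (nOf L))) ↪ Fin (L + anc P L) := Fin.castLEEmb (solver_fits' P L)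

/-- **The solver's circuit, verbatim on the front wires.** [cite: Regev2004, Lemma 3.12 (proof, p. 14: "It then calls the two point algorithm")] -/
def solverGates (L : ℕ) : List (QGate cliffordT (L + anc P L)) := (mapWires (solverEmb P L) (P.FD.circ (ell (nOf L)))).gates

/-- **The circuit of the routine on inputs of length `L`**: Hadamard coins, the compiled classical
program, the solver. [cite: Regev2004, Lemma 3.12 (proof, p. 14)] -/
def circ (L : ℕ) : QCircuit cliffordT (L + anc P L) := ⟨hGates P L ++ revCompile (clampR P L) ++ solverGates P L⟩

/-- **The family of the routine.** [cite: Regev2004, Lemma 3.12] -/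
def family : QCircuitFamily cliffordT := ⟨anc P, circ P⟩

/-- The family is oracle-free (if the solver is). [folklore] -/
theorem family_isOracleFree (hFD : P.FD.IsOracleFree) : (family P).IsOracleFree := by
  intro L g hg
  change g ∈ hGates P L ++ revCompile (clampR P L) ++ solverGates P L at hg
  rcases List.mem_append.1 hg with hg | hg
  · rcases List.mem_append.1 hg with hg | hg
    · obtain ⟨i, -, rfl⟩ := List.mem_map.1 hg
      trivial
    · exact revCompile_isOracleFree _ g hg
  · exact isOracleFree_mapWires _ (hFD _) g hg

/-! ### The basis permutation of the compiled program -/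

/-- **The basis permutation of the compiled classical program.** [folklore] -/
def kappa (L : ℕ) (z : QReg (L + anc P L)) : QReg (L + anc P L) := revEval (clampR P L) z

/-- `kappa`, lifted to `ℕ`-indexed wires, is the classical program. [folklore] -/
theorem liftW_kappa (L : ℕ) (z : QReg (L + anc P L)) : liftW (kappa P L z) = clEval (prog P L (nOf L)) (liftW z) := by
  unfold kappa clampR
  rw [revEval_toRevList]
  exact liftW_clEval_map (width_pos L) _ (prog_lt' (nOf_le L)) z

/-- `kappa` is injective. [folklore] -/
theorem kappa_injective (L : ℕ) : Function.Injective (kappa P L) := by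
  intro z z' h
  unfold kappa clampR at h
  rw [revEval_toRevList, revEval_toRevList] at h
  exact clEval_injective _ (fun op hop => by
    simp only [List.mem_map] at hop
    obtain ⟨op, hop, rfl⟩ := hop
    exact wf_map_finOf _ (prog_lt' (nOf_le L) op hop) (prog_wf (nOf_le L) op hop)) h

/-- `kappa` as a self-embedding of the basis labels. [folklore] -/
def kappaEmb (L : ℕ) : QReg (L + anc P L) ↪ QReg (L + anc P L) := ⟨kappa P L, kappa_injective P L⟩

/-- **The compiled program permutes basis states along `kappa`.** [cite: NielsenChuang2010, §3.2.5 (reversible classical computation on basis states)] -/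
theorem revCompile_mulVec (L : ℕ) (z : QReg (L + anc P L)) :
    (⟨revCompile (clampR P L)⟩ : QCircuit cliffordT (L + anc P L)).toMatrix 0 *ᵥ basisState z = basisState (kappa P L z) :=
  revCompile_mulVec_basisState 0 _ z

/-! ### The state after the Hadamard layer and after the compiled program -/

section States

variable {P}

/-- Values of `coinFin`. [folklore] -/
theorem mem_coinFin_iff {L : ℕ} (i : Fin (L + anc P L)) : i ∈ coinFin P L ↔ (i : ℕ) ∈ coinPos P L (nOf L) := by
  unfold coinFin
  rw [List.mem_map]
  constructor
  · rintro ⟨p, hp, rfl⟩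
    rwa [val_finOf_of_lt _ (by have := (coinPos_bounds (nOf_le L) hp).2; rw [add_anc]; exact this)]
  · intro h
    exact ⟨i, h, Fin.ext (val_finOf_of_lt _ i.isLt)⟩

/-- The coin wires of the register are distinct. [folklore] -/
theorem coinFin_nodup (L : ℕ) : (coinFin P L).Nodup := by
  unfold coinFin
  refine (coinPos_nodup (P := P) (nOf_le L)).map_on fun a ha b hb h => ?_
  have ha' := (coinPos_bounds (nOf_le L) ha).2
  have hb' := (coinPos_bounds (nOf_le L) hb).2
  rw [← add_anc] at ha' hb'
  have := congrArg Fin.val h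
  rwa [val_finOf_of_lt _ ha', val_finOf_of_lt _ hb'] at this

/-- The number of coins. [folklore] -/
def numCoins (P : Params) (L : ℕ) : ℕ := (coinPos P L (nOf L)).length

/-- **The state after the Hadamard layer**: the uniform superposition (amplitude `2^{-c/2}`,
`c = numCoins`) of the basis states agreeing with `|x⟩|0…0⟩` off the coin wires.
[cite: NielsenChuang2010, §1.4.4 (H^{⊗n}|0⟩)] -/
def stateH (P : Params) (x : List Bool) : QReg (x.length + anc P x.length) → ℂ := fun z =>
  if (∀ j, j ∉ coinFin P x.length → z j = padInput x.get (anc P x.length) j) then invSqrt2 ^ numCoins P x.length else 0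

/-- **The Hadamard layer on the input.** [cite: NielsenChuang2010, §1.4.4] -/
theorem hGates_mulVec_pad (x : List Bool) :
    (⟨hGates P x.length⟩ : QCircuit cliffordT (x.length + anc P x.length)).toMatrix 0 *ᵥ basisState (padInput x.get (anc P x.length)) =
      stateH P x := by
  unfold hGates stateH
  rw [hadamards_mulVec_basisState (coinFin P x.length) (coinFin_nodup x.length) _ (fun i hi => ?_)]
  · unfold numCoins coinFin; rw [List.length_map]
  · rw [mem_coinFin_iff] at hi
    have h1 := (coinPos_bounds (nOf_le x.length) hi).1
    have := congrFun (CWrap.liftW_padInput_get x (anc P x.length)) i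
    rw [liftW_val] at this
    rw [this, strW, List.getD_eq_default _ _ h1]

/-- **The state after the compiled program**: the Hadamard state transported along `kappa`.
[cite: NielsenChuang2010, §3.2.5 (reversible classical computation on basis states)] -/
def stateQ (P : Params) (x : List Bool) : QReg (x.length + anc P x.length) → ℂ := fun y =>
  stateH P x ((kappaEmb P x.length).equivOfFiniteSelfEmbedding.symm y)

/-- The compiled program on the Hadamard state. [folklore] -/
theorem revCompile_mulVec_stateH (x : List Bool) :
    (⟨revCompile (clampR P x.length)⟩ : QCircuit cliffordT (x.length + anc P x.length)).toMatrix 0 *ᵥ stateH P x = stateQ P x :=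
  mulVec_eq_of_perm (kappaEmb P x.length) (revCompile_mulVec P x.length) (stateH P x)

/-- **`stateQ` on the image of `kappa`** is the Hadamard amplitude of the preimage. [folklore] -/
theorem stateQ_kappa (x : List Bool) (z : QReg (x.length + anc P x.length)) : stateQ P x (kappa P x.length z) = stateH P x z := by
  unfold stateQ
  congr 1
  exact (kappaEmb P x.length).equivOfFiniteSelfEmbedding.symm_apply_eq.2 rfl

/-- **The final state of the routine** on the input `x`: the solver's circuit, placed on the front
wires, applied to `stateQ`. [cite: Regev2004, Lemma 3.12 (proof, p. 14)] -/
theorem runOn_circ (x : List Bool) :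
    (circ P x.length).runOn 0 (basisState (padInput x.get (anc P x.length))) =
      placeGate (solverEmb P x.length) ((P.FD.circ (ell (nOf x.length))).toMatrix 0) *ᵥ stateQ P x := by
  have e : circ P x.length = ((⟨hGates P x.length⟩ : QCircuit cliffordT _).append ⟨revCompile (clampR P x.length)⟩).append
      (mapWires (solverEmb P x.length) (P.FD.circ (ell (nOf x.length)))) := by
    simp only [circ, QCircuit.append, solverGates]
  rw [QCircuit.runOn, e, QCircuit.toMatrix_append, QCircuit.toMatrix_append, ← Matrix.mulVec_mulVec, ← Matrix.mulVec_mulVec,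
    hGates_mulVec_pad, revCompile_mulVec_stateH, toMatrix_mapWires]

/-- **The output kernel of the family** on `x`: the Born sum of the final state.
[cite: NielsenChuang2010, §2.2.5 (Born rule)] -/
theorem kernelProb_family_eq (x : List Bool) (EV : Set (List Bool)) [DecidablePred (· ∈ EV)] :
    (family P).kernelProb 0 x EV = ∑ z : QReg (x.length + anc P x.length),
      if List.ofFn z ∈ EV then ‖(placeGate (solverEmb P x.length) ((P.FD.circ (ell (nOf x.length))).toMatrix 0) *ᵥ stateQ P x) z‖ ^ 2 else 0 := by
  change ((((circ P x.length).outputPMF 0 x.get).map List.ofFn).toOuterMeasure EV).toReal = _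
  rw [toReal_outputPMF_map_ofFn, runOn_circ]

/-- **Branch decomposition of the Born weight of a product event.** For an event asking `Toff` of
the content off the solver's wires (the zero-block representative) and `TE` of the content of the
solver's wires, the Born weight after the routine is the sum over the off-block contents `y` in
`Toff` of the event probabilities of the solver's circuit on the branches
`u ↦ stateQ (extend E u y)` of `stateQ` (deferred measurement). [cite: NielsenChuang2010, §4.4 (principle of deferred measurement)] -/
theorem bornSum_product_event (x : List Bool) (Toff : QReg (x.length + anc P x.length) → Prop) [DecidablePred Toff]
    (TE : QReg (ell (nOf x.length) + P.FD.ancillas (ell (nOf x.length))) → Prop) [DecidablePred TE] :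
    (∑ z : QReg (x.length + anc P x.length),
      if Toff (Function.extend (solverEmb P x.length) (fun _ => false) z) ∧ TE (z ∘ solverEmb P x.length) then
        ‖(placeGate (solverEmb P x.length) ((P.FD.circ (ell (nOf x.length))).toMatrix 0) *ᵥ stateQ P x) z‖ ^ 2 else 0) =
      ∑ y : QReg (x.length + anc P x.length), if (∀ j, y (solverEmb P x.length j) = false) ∧ Toff y then
        (P.FD.circ (ell (nOf x.length))).probEvent 0 (fun u => stateQ P x (Function.extend (solverEmb P x.length) u y)) {u | TE u}
      else 0 :=
  sum_ite_normSq_placeGate_eq_sum_probEvent 0 (solverEmb P x.length) (P.FD.circ (ell (nOf x.length))) (stateQ P x) Toff TE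

end States

end RegevRoutine

end Literature.Algebra.EuclideanLattices

end
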